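import Literature.NumberTheory.Rogawski1990.RankOneUnstableWildTorusWrapper   -- ★ p844450 + ED. 2 p844466 (B-p12 (g30)): `descent_scalars_ne_zero`, the `hpos`-keyed torus wrappers
import HarnessLib

/-!
# [LabesseLanglands1979 §2 (2.1); Rogawski1990 §3.6] road «W′» = «R1LL-WILD», (B6-O) FILE B — ADAPTER: STANDARD POSITION AT `t₀` FROM THE PER-`t` DESCENT
# (the CLOSE v4 ∕ ★ A-p13 ED. 2 binder `hpos : ∀ t, ∃ s γ a b, γ = (a, b v₀; b, a + b u₀) ∧ diag(1,α)·X_t·diag(1,α)⁻¹ = s • ι γ` ⇒ the `t₀`-form `∃ s a b, b ≠ 0 ∧ …` of ★ p844450)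

Topic `NumberTheory/Rogawski1990`; namespace `Literature.NumberTheory.Rogawski1990`.  THEOREMS ONLY (no definition, no instance, no notation, no named fact, no `sorry`).
Cell `pub/hodgecm-mathlib` (D-0151), crux H413 = `stmt-HodgeConjecture-24833`; hand B-p12 (g30).  The (W′-B6) CLOSE v4 of F0P3-p01 (g15) (CERT f86ad281) carries the standard
position in the PER-`t` ∀-form (without `b ≠ 0`), while ★ p844450's torus wrappers take v3's `t₀`-form `∃ s a b, b ≠ 0 ∧ …`; `b ≠ 0` at `t₀` is FORCED by the regularity of `t₀`
(★ `descent_scalars_ne_zero` on the frame at `w`).  So the CLOSE's `hOt` is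
`fun mfl oT κT hspec => exists_depth_sign_dictionary_torus_of_symbol … hα hα0 hv0 … (exists_standardPosition_of_forall_descent … hpos) bc Nb hbc mfl oT κT hspec`.
HONEST LABEL: HC_CM is proved only modulo the printed citations (hLiu418, h413) until rung 0 closes; bookkeeping only.

## References
* [LabesseLanglands1979] J.-P. Labesse, R. P. Langlands, *L-indistinguishability for SL(2)*, Canad. J. Math. 31 (1979): §2 (2.1) p. 8.
* [Rogawski1990] J. D. Rogawski, *Automorphic Representations of Unitary Groups in Three Variables*, Ann. of Math. Stud. 123 (1990): §3.6 pp. 31–32.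
-/

set_option autoImplicit false

noncomputable section

open NumberField IsDedekindDomain Matrix ValuativeRel
open scoped Matrix MatrixGroups

namespace Literature.NumberTheory.Rogawski1990

open Literature.NumberTheory.Automorphic Literature.NumberTheory.Automorphic.UnitaryGroup Literature.NumberTheory.GaloisRepresentations
open Literature.NumberTheory.QuadraticForms Literature.NumberTheory.NumberFields

section Adapter

variable (L : Type) [Field L] [NumberField L] [IsCMField L] (v : HeightOneSpectrum (𝓞 ↥(maximalRealSubfield L)))
  (w : PlacesOver L v) (hw : IsCMField.complexConj L • w.1 = w.1)
  (t₀ : ((cmDatum L 2 (Matrix.of fun i j : Fin 2 => if i.val + j.val + 1 = 2 then (1 : L) else 0)).Local v × (cmDatum L 1 (Matrix.of fun i j : Fin 1 => if i.val + j.val + 1 = 1 then (1 : L) else 0)).Local v)) (P : GL (Fin 2) (LocalRing L v)) (d : Fin 2 → LocalRing L v)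
  (ht₀ : IsRegularElt (t₀.1.val : GL (Fin 2) (LocalRing L v)))
  (hP : (t₀.1.val.val : Matrix (Fin 2) (Fin 2) (LocalRing L v)) * P.val = P.val * Matrix.diagonal d) (hd1 : ∀ i, conjLocal L (IsCMField.complexConj L) v (d i) * d i = 1)
  (E₂ : (cmDatum L 2 (Matrix.of fun i j : Fin 2 => if i.val + j.val + 1 = 2 then (1 : L) else 0)).Local v ≃ₜ* ↥(unitaryGroupOfForm (galAdicCompletionMap (L := L) (IsCMField.complexConj L) hw) (placeForm (Matrix.of fun i j : Fin 2 => if i.val + j.val + 1 = 2 then (1 : L) else 0) w.1)))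
  (hE₂ : ∀ g, ((E₂ g : ↥(unitaryGroupOfForm (galAdicCompletionMap (L := L) (IsCMField.complexConj L) hw) (placeForm (Matrix.of fun i j : Fin 2 => if i.val + j.val + 1 = 2 then (1 : L) else 0) w.1))) : GL (Fin 2) (w.1.adicCompletion L)) = ((localNonsplitEquiv (IsCMField.complexConj L) (Matrix.of fun i j : Fin 2 => if i.val + j.val + 1 = 2 then (1 : L) else 0) (IsCMField.complexConj_ne_one L) w hw g : ↥(unitaryGroupOfForm (galAdicCompletionMap (L := L) (IsCMField.complexConj L) hw) (placeForm (Matrix.of fun i j : Fin 2 => if i.val + j.val + 1 = 2 then (1 : L) else 0) w.1))) : GL (Fin 2) (w.1.adicCompletion L)))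

include hw ht₀ hP hd1 hE₂

-- `L_w`-sized statement: elaboration budget only (no search)
set_option maxHeartbeats 1600000 in
/-- **STANDARD POSITION AT `t₀` FROM THE PER-`t` DESCENT**: if every `t ∈ Z(t₀)` descends (`diag(1,α)·X_t·diag(1,α)⁻¹ = s_t • ι(a_t + b_t M_τ)`, `α ≠ 0`), then at `t₀` itself
`b ≠ 0` — `t₀` is REGULAR, so its frame eigenvalues at `w` differ and ★ `descent_scalars_ne_zero` applies to the frame `P_w` (★ `coe_localNonsplitEquiv_mul_map_eq`).
This is v3's `hpos` from v4's. [cite: LabesseLanglands1979, §2 (2.1)] [cite: Rogawski1990, §3.6 pp. 31–32] -/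
theorem exists_standardPosition_of_forall_descent {α : (w.1.adicCompletion L)} (hα0 : α ≠ 0) {u₀ v₀ : (v.adicCompletion ↥(maximalRealSubfield L))}
    (hdesc : ∀ t : ↥(Subgroup.centralizer ({t₀} : Set ((cmDatum L 2 (Matrix.of fun i j : Fin 2 => if i.val + j.val + 1 = 2 then (1 : L) else 0)).Local v × (cmDatum L 1 (Matrix.of fun i j : Fin 1 => if i.val + j.val + 1 = 1 then (1 : L) else 0)).Local v))), ∃ (s : (w.1.adicCompletion L)) (γ : GL (Fin 2) (v.adicCompletion ↥(maximalRealSubfield L))) (a b : (v.adicCompletion ↥(maximalRealSubfield L))), (γ : Matrix (Fin 2) (Fin 2) (v.adicCompletion ↥(maximalRealSubfield L))) = !![a, b * v₀; b, a + b * u₀] ∧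
      Matrix.diagonal ![1, α] * ((((E₂ (t : ((cmDatum L 2 (Matrix.of fun i j : Fin 2 => if i.val + j.val + 1 = 2 then (1 : L) else 0)).Local v × (cmDatum L 1 (Matrix.of fun i j : Fin 1 => if i.val + j.val + 1 = 1 then (1 : L) else 0)).Local v)).1 : ↥(unitaryGroupOfForm (galAdicCompletionMap (L := L) (IsCMField.complexConj L) hw) (placeForm (Matrix.of fun i j : Fin 2 => if i.val + j.val + 1 = 2 then (1 : L) else 0) w.1))) : GL (Fin 2) (w.1.adicCompletion L)) : Matrix (Fin 2) (Fin 2) (w.1.adicCompletion L))) * Matrix.diagonal ![1, α⁻¹] = s • (γ : Matrix (Fin 2) (Fin 2) (v.adicCompletion ↥(maximalRealSubfield L))).map (toPlace v w)) :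
    ∃ (s : (w.1.adicCompletion L)) (a b : (v.adicCompletion ↥(maximalRealSubfield L))), b ≠ 0 ∧
      Matrix.diagonal ![1, α] * ((((E₂ t₀.1 : ↥(unitaryGroupOfForm (galAdicCompletionMap (L := L) (IsCMField.complexConj L) hw) (placeForm (Matrix.of fun i j : Fin 2 => if i.val + j.val + 1 = 2 then (1 : L) else 0) w.1))) : GL (Fin 2) (w.1.adicCompletion L)) : Matrix (Fin 2) (Fin 2) (w.1.adicCompletion L))) * Matrix.diagonal ![1, α⁻¹] = s • (!![a, b * v₀; b, a + b * u₀]).map (toPlace v w) := by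
  classical
  have ht0mem : t₀ ∈ Subgroup.centralizer ({t₀} : Set ((cmDatum L 2 (Matrix.of fun i j : Fin 2 => if i.val + j.val + 1 = 2 then (1 : L) else 0)).Local v × (cmDatum L 1 (Matrix.of fun i j : Fin 1 => if i.val + j.val + 1 = 1 then (1 : L) else 0)).Local v)) := Subgroup.mem_centralizer_iff.2 fun g hg => by rw [Set.mem_singleton_iff.1 hg]
  obtain ⟨s, γ, a, b, hγ, hG⟩ := hdesc ⟨t₀, ht0mem⟩
  rw [hγ] at hG
  refine ⟨s, a, b, ?_, hG⟩
  -- the frame at `w` for `t := t₀`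
  set Pw : GL (Fin 2) (w.1.adicCompletion L) := Matrix.GeneralLinearGroup.map (Pi.evalRingHom (fun w' : PlacesOver L v => w'.1.adicCompletion L) w) P with hPwdef
  have hQu : IsUnit (Pw : Matrix (Fin 2) (Fin 2) (w.1.adicCompletion L)).det := (Matrix.isUnit_iff_isUnit_det _).1 Pw.isUnit
  have hDD : Matrix.diagonal ![(1 : (w.1.adicCompletion L)), α⁻¹] * Matrix.diagonal ![1, α] = 1 := by
    rw [Matrix.diagonal_mul_diagonal, ← Matrix.diagonal_one]; congr 1; ext i; fin_cases i <;> simp [inv_mul_cancel₀ hα0]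
  have hPt := frame_of_mem_centralizer L v w hw t₀ P d ht₀ hP hd1 ⟨t₀, ht0mem⟩
  have hTt := coe_localNonsplitEquiv_mul_map_eq L v w hw t₀.1 P _ hPt
  rw [← hE₂, ← hPwdef, Matrix.diagonal_map (map_zero _)] at hTt
  have hdτ : (Matrix.diagonal fun i => Pi.evalRingHom (fun w' : PlacesOver L v => w'.1.adicCompletion L) w (![((P⁻¹).val * (((⟨t₀, ht0mem⟩ : ↥(Subgroup.centralizer ({t₀} : Set ((cmDatum L 2 (Matrix.of fun i j : Fin 2 => if i.val + j.val + 1 = 2 then (1 : L) else 0)).Local v × (cmDatum L 1 (Matrix.of fun i j : Fin 1 => if i.val + j.val + 1 = 1 then (1 : L) else 0)).Local v)))) : ((cmDatum L 2 (Matrix.of fun i j : Fin 2 => if i.val + j.val + 1 = 2 then (1 : L) else 0)).Local v × (cmDatum L 1 (Matrix.of fun i j : Fin 1 => if i.val + j.val + 1 = 1 then (1 : L) else 0)).Local v)).1.val.val : Matrix (Fin 2) (Fin 2) (LocalRing L v)) * P.val) 0 0, ((P⁻¹).val * (((⟨t₀, ht0mem⟩ : ↥(Subgroup.centralizer ({t₀}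 : Set ((cmDatum L 2 (Matrix.of fun i j : Fin 2 => if i.val + j.val + 1 = 2 then (1 : L) else 0)).Local v × (cmDatum L 1 (Matrix.of fun i j : Fin 1 => if i.val + j.val + 1 = 1 then (1 : L) else 0)).Local v)))) : ((cmDatum L 2 (Matrix.of fun i j : Fin 2 => if i.val + j.val + 1 = 2 then (1 : L) else 0)).Local v × (cmDatum L 1 (Matrix.of fun i j : Fin 1 => if i.val + j.val + 1 = 1 then (1 : L) else 0)).Local v)).1.val.val : Matrix (Fin 2) (Fin 2) (LocalRing L v)) * P.val) 1 1] i)) =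
      Matrix.diagonal ![((P⁻¹).val * (((⟨t₀, ht0mem⟩ : ↥(Subgroup.centralizer ({t₀} : Set ((cmDatum L 2 (Matrix.of fun i j : Fin 2 => if i.val + j.val + 1 = 2 then (1 : L) else 0)).Local v × (cmDatum L 1 (Matrix.of fun i j : Fin 1 => if i.val + j.val + 1 = 1 then (1 : L) else 0)).Local v)))) : ((cmDatum L 2 (Matrix.of fun i j : Fin 2 => if i.val + j.val + 1 = 2 then (1 : L) else 0)).Local v × (cmDatum L 1 (Matrix.of fun i j : Fin 1 => if i.val + j.val + 1 = 1 then (1 : L) else 0)).Local v)).1.val.val : Matrix (Fin 2) (Fin 2) (LocalRing L v)) * P.val) 0 0 w, ((P⁻¹).val * (((⟨t₀, ht0mem⟩ : ↥(Subgroup.centralizer ({t₀} : Set ((cmDatum L 2 (Matrix.of fun i j : Fin 2 => if i.val + j.val + 1 = 2 then (1 : L) else 0)).Local v × (cmDatum L 1 (Matrix.of fun i j : Fin 1 => if i.val + j.val + 1 = 1 then (1 : L) else 0)).Local v)))) : ((cmDatum L 2 (Matrix.of fun i j : Fin 2 => if i.val + j.val + 1 = 2 then (1 : L) else 0)).Local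 v × (cmDatum L 1 (Matrix.of fun i j : Fin 1 => if i.val + j.val + 1 = 1 then (1 : L) else 0)).Local v)).1.val.val : Matrix (Fin 2) (Fin 2) (LocalRing L v)) * P.val) 1 1 w] := by
    congr 1; funext i; fin_cases i <;> rfl
  rw [hdτ] at hTt
  -- regularity of `t₀`: distinct eigenvalues, of norm one
  have hc1 := conjLocal_frameEntry_mul_self_apply L v w hw t₀ P d ht₀ hP hd1 ⟨t₀, ht0mem⟩ 1
  have hv1' := valued_apply_eq_one_of_conjLocal_mul_self L v w hw hc1
  have hx1ne : ((P⁻¹).val * (((⟨t₀, ht0mem⟩ : ↥(Subgroup.centralizer ({t₀} : Set ((cmDatum L 2 (Matrix.of fun i j : Fin 2 => if i.val + j.val + 1 = 2 then (1 : L) else 0)).Local v × (cmDatum L 1 (Matrix.of fun i j : Fin 1 => if i.val + j.val + 1 = 1 then (1 : L) else 0)).Local v)))) : ((cmDatum L 2 (Matrix.of fun i j : Fin 2 => if i.val + j.val + 1 = 2 then (1 : L) else 0)).Local v × (cmDatum L 1 (Matrix.of fun i j : Fin 1 => if i.val + j.val + 1 = 1 then (1 : L) else 0)).Local v)).1.val.val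 : Matrix (Fin 2) (Fin 2) (LocalRing L v)) * P.val) 1 1 w ≠ 0 := fun h0 => by rw [h0, map_zero] at hv1'; exact zero_ne_one hv1'
  have hne := (localRing_ne_iff_apply_ne L v w hw _ _).1 ((isRegularElt_iff_frameEntry_ne L v w hw t₀ P d ht₀ hP hd1 ⟨t₀, ht0mem⟩).1 ht₀)
  exact (descent_scalars_ne_zero (toPlace v w) hTt hDD hG hQu hne hx1ne).2

end Adapter

end Literature.NumberTheory.Rogawski1990

end
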